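import Summits.BirchSwinnertonDyer.Rank1Residual.Additive.GoodModelReducedAutLift
import Summits.BirchSwinnertonDyer.Rank1Residual.Additive.GoodModelReductionLine
import Summits.BirchSwinnertonDyer.Rank1Residual.Additive.InertiaKummerRootOfUnity
import HarnessLib

/-!
# On a Kummer model `C = ⟨u, 0, 0, 0⟩ · Cs` an inertial `σ` acts trivially on `E[p^∞]/C` iff it
# FIXES the Kummer element `u` — the exact kernel of the quotient character, model level
# (cell `b2b-bsdres`, team n1011, seat p07 (gen 8); row T-ROL-ORD FILE F2)

HONEST FRAMING (cell `b2b-bsdres`, run/shared/lean/b2b/bsd-rank1-residual/, verbatim in every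
file): the goal of the cell is to DELETE the COMBINATION-SHAPED residual classes of the
Birch–Swinnerton-Dyer formula for ALL analytic-rank `≤ 1` elliptic curves over `ℚ` — "full BSD
formula for every rank `≤ 1` curve in class `C`" assembled STRICTLY from published theorems — so
that the rank-`≤ 1` remainder becomes exactly the CONSTRUCTION-SHAPED classes, which are TYPED
(missing-input `Prop`s), NOT attempted. This is not "finishing BSD". Team n1011 (N10/N11): research
route on the CONSTRUCTION-SHAPED classes X3♯(G-ord)/X4♯(G-ord); prove what is provable now; no
claim beyond stated classes; census output = EVIDENCE, never a Literature fact; RESIDUAL-MAP marks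
UNCHANGED; nothing is booked by this file. TOOL theorems only: NO definition, NO named fact, NO
conjecture node.

## What and why

T-ROL-EXP (gen 7) built the Kummer–Deuring good model `W₀ = C • E ⊗ K̄_v`,
`C = ⟨u, 0, 0, 0⟩ · Cs` with `Cs` over `ℚ` and `u^e = p^m` (A2/A3), and proved: an inertial `σ`
FIXING `u` acts trivially on `E[p^∞]/C` (B §1, F-A1). This file proves the CONVERSE, so that the
kernel of the quotient character `ϑ : I_v → Aut(E[p^∞]/C)` is EXACTLY the fixing group of `u`:

* §1 `map_eq_scaling_mul` — pure algebra: if `ψ u = ζ u` then `ψ(C) = ⟨ζ, 0, 0, 0⟩ · C`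
  (`r, s, t` come from `ℚ`), so the descent datum `C (ψC)⁻¹` is the scaling `⟨ζ⁻¹, 0, 0, 0⟩`
  (`mul_inv_scaling_eq`).
* §2 (p05's F-A setting: `hW₀ hΔ red hred`, the ordinary point `hord`, the datum `Lv` with
  `m ∈ C ↔ red(Φ_C(ι m)) = 0`) **`forall_smul_sub_mem_plus_iff_smul_eq`**: for `σ ∈ I_v` with
  `σ(u^e) = u^e`, `p ∤ e`: `(∀ m, σm − m ∈ C) ↔ σ u = u`. (⇐) is F-A1
  `goodReductionHom_pointEquiv_map_eq_of_map_eq`; (⇒): `ζ := σu/u` is an `e`-th root of unity, the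
  Serre–Tate reduced automorphism is the reduction of `⟨ζ⁻¹, 0, 0, 0⟩` (F1
  `exists_lift_reducedAut_red_map_eq`), it fixes the infinitely many reductions of `p`-power torsion
  points (F-A2 `infinite_range_red_pointsMap`), so it is `1` (`eq_one_of_infinite_fixedPoints`),
  i.e. `ζ ≡ 1 (mod 𝔪_w)`, whence `ζ = 1` (A1 `eq_one_of_pow_eq_one_of_specVal_sub_one_lt`).

Consequence (row files F3/F4): the quotient character has EXACTLY the kernel `{σ : σ θ = θ}`,
`θ^e = p`, hence exact order `e` by the surjectivity of the Kummer character (Serre 1972 §1.3,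
§5.6; Serre–Tate 1968 §2 Cor. 2: the inertia group of the field of good reduction acts faithfully).

References: J.-P. Serre, J. Tate, Ann. of Math. 88 (1968) §2 Thm. 2, Cor. 2 [SerreTate1968];
J.-P. Serre, Invent. Math. 15 (1972) §1.3, §5.6 [Serre1972]; J. H. Silverman, *AEC* 2nd ed.
VII.1.3(d), VII.2.1, VII.5.5, III.10 [SilvermanAEC2009]; cells/n1011/skel/T-ROL-ORD.md.
-/

noncomputable section

open scoped Classical NNReal

open WeierstrassCurve

universe u

namespace Summit.BirchSwinnertonDyer.Rank1Residual.Additive.GoodModelLine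

open Literature.NumberTheory.EllipticCurves

/-! ## §1 The descent datum of a Kummer model under `u ↦ ζ u` is the scaling `⟨ζ⁻¹, 0, 0, 0⟩` -/

section Algebra

variable {L : Type u} [Field L]

/-- **`ψ(⟨u,0,0,0⟩ · Cs) = ⟨ζ,0,0,0⟩ · (⟨u,0,0,0⟩ · Cs)` when `ψ u = ζ u`** and `Cs` is defined
over `ℚ` (every ring endomorphism of `L` fixes `ℚ`). [folklore] -/
theorem map_eq_scaling_mul (φ : ℚ →+* L) {u : L} (hu0 : u ≠ 0) (Cs : VariableChange ℚ)
    (ψ : L →+* L) {ζ : L} (hζ0 : ζ ≠ 0) (hψu : ψ u = ζ * u) :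
    ((⟨Units.mk0 u hu0, 0, 0, 0⟩ : VariableChange L) * Cs.map φ).map ψ =
      (⟨Units.mk0 ζ hζ0, 0, 0, 0⟩ : VariableChange L) * (⟨Units.mk0 u hu0, 0, 0, 0⟩ * Cs.map φ) := by
  have hψφ : ψ.comp φ = φ := Subsingleton.elim _ _
  have hCs : (Cs.map φ).map ψ = Cs.map φ := by rw [VariableChange.map_map, hψφ]
  have hCu : (⟨Units.mk0 u hu0, 0, 0, 0⟩ : VariableChange L).map ψ =
      (⟨Units.mk0 ζ hζ0, 0, 0, 0⟩ : VariableChange L) * ⟨Units.mk0 u hu0, 0, 0, 0⟩ := by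
    rw [VariableChange.mul_def]
    ext
    · simp [VariableChange.map, hψu]
    · simp [VariableChange.map]
    · simp [VariableChange.map]
    · simp [VariableChange.map]
  rw [show ((⟨Units.mk0 u hu0, 0, 0, 0⟩ : VariableChange L) * Cs.map φ).map ψ =
      (⟨Units.mk0 u hu0, 0, 0, 0⟩ : VariableChange L).map ψ * (Cs.map φ).map ψ
    from map_mul (VariableChange.mapHom ψ) _ _, hCu, hCs, mul_assoc]

/-- **The descent datum is the scaling `⟨ζ⁻¹, 0, 0, 0⟩`**: `C (ψC)⁻¹ = ⟨ζ⁻¹, 0, 0, 0⟩` when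
`ψC = ⟨ζ, 0, 0, 0⟩ · C`. [folklore] -/
theorem mul_inv_eq_scaling_of_map_eq {C D : VariableChange L} {Z : Lˣ}
    (h : D = (⟨Z, 0, 0, 0⟩ : VariableChange L) * C) :
    C * D⁻¹ = ⟨Z⁻¹, 0, 0, 0⟩ := by
  rw [h, mul_inv_rev, mul_inv_cancel_left, VariableChange.inv_def]
  ext <;> simp

end Algebra

/-! ## §2 The kernel of the quotient character is the fixing group of `u` -/

section Local

open NumberField IsDedekindDomain Field IsDedekindDomain.HeightOneSpectrum
  Literature.NumberTheory.GaloisRepresentations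
  Literature.NumberTheory.EllipticCurves.GreenbergSelmer
  Literature.NumberTheory.EllipticCurves.EmertonPollackWeston2006
  Summit.BirchSwinnertonDyer.Rank1Residual.X2.GreenbergVatsalReductionDatum
  Summit.BirchSwinnertonDyer.Rank1Residual.X2.GreenbergVatsalTateDatumCofree

variable (W : WeierstrassCurve ℚ) [W.IsElliptic] (p : ℕ) [hp : Fact p.Prime]
  {v : HeightOneSpectrum (𝓞 ℚ)}
  {C : VariableChange (AlgebraicClosure (v.adicCompletion ℚ))}
  {W₀ : WeierstrassCurve (specVal v).integer}
  (hW₀ : C • (W.baseChange (v.adicCompletion ℚ)).baseChange (AlgebraicClosure (v.adicCompletion ℚ)) =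
    W₀.baseChange (AlgebraicClosure (v.adicCompletion ℚ)))
  (hΔ : IsUnit W₀.Δ)
  (red : localPoints W (v.adicCompletion ℚ) →+
    (W₀.map (IsLocalRing.residue (specVal v).integer)).toAffine.Point)
  (hred : ∀ P, red P = goodReductionHom W₀ (Valuation.integer.integers (specVal v)) hΔ
    (Affine.Point.congrEquiv hW₀ (VariableChange.pointEquiv _ C
      (Affine.Point.congrEquiv (baseChange_baseChange_adicCompletion W v).symm P))))
  (hord : ∃ P : (W₀.baseChange (AlgebraicClosure (v.adicCompletion ℚ))).toAffine.Point,
    (p : ℤ) • P = 0 ∧ goodReductionHom W₀ (Valuation.integer.integers (specVal v)) hΔ P ≠ 0)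
  (Lv : LocalDatum ℚ (W.geomPrimaryTorsion p) v)
  (hLv : ∀ m, m ∈ Lv.plus ↔ red (pointsMap W (v.adicCompletion ℚ) (m : W.geomPoints)) = 0)

omit [W.IsElliptic] hp in
include hred hLv in
/-- **An inertial `σ` FIXING the change of variables acts trivially on `E[p^∞]/C`** (single-`σ`
form of T-ROL-EXP B §1 `pow_smul_sub_mem_plus_of_map_pow_eq`; F-A1
`goodReductionHom_pointEquiv_map_eq_of_map_eq`). [cite: SilvermanAEC2009, Prop. VII.2.1]
[cite: SerreTate1968, §2 Thm. 2 (mechanism of proof)] -/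
theorem smul_sub_mem_plus_of_map_toAlgEquiv_eq {σ : absoluteGaloisGroup (v.adicCompletion ℚ)}
    (hσ : σ ∈ absInertia (v.adicCompletion ℚ))
    (hC : C.map ((absoluteGaloisGroup.toAlgEquiv _ σ :
        AlgebraicClosure (v.adicCompletion ℚ) ≃ₐ[v.adicCompletion ℚ]
          AlgebraicClosure (v.adicCompletion ℚ)) :
        AlgebraicClosure (v.adicCompletion ℚ) →+* AlgebraicClosure (v.adicCompletion ℚ)) = C)
    (m : W.geomPrimaryTorsion p) :
    absGaloisRestrict ℚ (v.adicCompletion ℚ) σ • m - m ∈ Lv.plus := by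
  obtain ⟨𝔐, h𝔐⟩ := v.localPrimesAbove_nonempty
  have hσI' : σ ∈ 𝔐.inertia (absoluteGaloisGroup (v.adicCompletion ℚ)) := by
    rw [inertia_eq_absInertia (specVal_spec v) h𝔐]; exact hσ
  have hmove := (mem_inertia_iff_spectralValuation (specVal_spec v) h𝔐).1 hσI'
  rw [hLv, AddSubgroupClass.coe_sub, primaryComponent.coe_smul, map_sub,
    pointsMap_absGaloisRestrict_smul, map_sub, sub_eq_zero, hred, hred, congrEquiv_smul W v σ]
  exact goodReductionHom_pointEquiv_map_eq_of_map_eq (W.baseChange (v.adicCompletion ℚ)) C hW₀ hΔ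
    (absoluteGaloisGroup.toAlgEquiv _ σ) (fun z ↦ spectralValuation_smul (specVal_spec v) σ z)
    hmove hC _

set_option maxHeartbeats 400000 in -- the Serre–Tate transport elaborates near the default cliff (as F-A3 §2)
include hred hLv hord in
/-- **THE KERNEL OF THE QUOTIENT CHARACTER OF A KUMMER MODEL IS THE FIXING GROUP OF `u`.** In p05's
F-A setting (a good model `W₀ = C • E ⊗ K̄_v`, the ordinary point, the datum `Lv` with
`m ∈ C ↔ red(Φ_C(ι m)) = 0`), assume the change of variables has the Kummer shape
`C = ⟨u, 0, 0, 0⟩ · Cs` with `Cs` over `ℚ` (T-ROL-EXP A2/A3). Then for every local inertia element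
`σ` with `σ(u^e) = u^e`, `e ≠ 0`, `p ∤ e` (e.g. `u^e = p^m`): **`σ` acts trivially on `E[p^∞]/C`
iff `σ u = u`.** (⇐): an inertial isometry fixing `C` does not change reductions (F-A1). (⇒):
`ζ := σu/u` satisfies `ζ^e = 1`; by §1 the descent datum `C (σC)⁻¹` is `⟨ζ⁻¹, 0, 0, 0⟩`, whose
reduction `Ã` is the Serre–Tate automorphism through which `σ` acts on `W̃₀` (F1
`exists_lift_reducedAut_red_map_eq`); `σ` trivial on `E[p^∞]/C` makes `Ã` fix the infinitely many
reductions of `p`-power torsion points (F-A2 `infinite_range_red_pointsMap`), so `Ã = 1`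
(`eq_one_of_infinite_fixedPoints`), i.e. `ζ⁻¹ ≡ 1 (mod 𝔪_w)`; an `e`-th root of unity `≡ 1` with
`p ∤ e` is `1` (A1 `eq_one_of_pow_eq_one_of_specVal_sub_one_lt`). Serre–Tate 1968 §2 Cor. 2 (the
inertia group of the field of good reduction acts faithfully on the special fibre) for the
étale quotient of an ordinary good model, in coordinates. [cite: SerreTate1968, §2 Thm. 2 and Cor. 2]
[cite: SilvermanAEC2009, VII.1 Prop. 1.3(d), VII.2 Prop. 2.1 and III.10]
[cite: Serre1972, §5.6 (p. 312)] -/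
theorem forall_smul_sub_mem_plus_iff_smul_eq (hpv : ((p : ℕ) : 𝓞 ℚ) ∈ v.asIdeal)
    {u : AlgebraicClosure (v.adicCompletion ℚ)} (hu0 : u ≠ 0) (Cs : VariableChange ℚ)
    (hC : C = ⟨Units.mk0 u hu0, 0, 0, 0⟩ *
      Cs.map (algebraMap ℚ (AlgebraicClosure (v.adicCompletion ℚ))))
    {e : ℕ} (he0 : e ≠ 0) (hpe : ¬ p ∣ e)
    {σ : absoluteGaloisGroup (v.adicCompletion ℚ)} (hσ : σ ∈ absInertia (v.adicCompletion ℚ))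
    (hσue : σ • (u ^ e) = u ^ e) :
    (∀ m : W.geomPrimaryTorsion p, absGaloisRestrict ℚ (v.adicCompletion ℚ) σ • m - m ∈ Lv.plus) ↔
      σ • u = u := by
  let L := AlgebraicClosure (v.adicCompletion ℚ)
  set ψ : L ≃ₐ[v.adicCompletion ℚ] L := absoluteGaloisGroup.toAlgEquiv _ σ with hψ
  have hψu_def : σ • u = ψ u := rfl
  constructor
  swap
  · -- (⇐) `σ` fixes `u`, hence `C`
    intro hσu m
    refine smul_sub_mem_plus_of_map_toAlgEquiv_eq W p hW₀ hΔ red hred Lv hLv hσ ?_ m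
    have h1 : ψ u = 1 * u := by rw [one_mul, ← hψu_def, hσu]
    have h := map_eq_scaling_mul (algebraMap ℚ L) hu0 Cs (ψ : L →+* L) one_ne_zero h1
    rw [← hC] at h
    rw [h]
    have h1' : (⟨Units.mk0 (1 : L) one_ne_zero, 0, 0, 0⟩ : VariableChange L) = 1 := by
      rw [VariableChange.one_def]; ext <;> simp
    rw [h1', one_mul]
  · -- (⇒)
    intro hH
    obtain ⟨𝔐, h𝔐⟩ := v.localPrimesAbove_nonempty
    -- `ζ := σ u / u`, an `e`-th root of unity
    set ζ : L := ψ u * u⁻¹ with hζ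
    have hψu : ψ u = ζ * u := by rw [hζ, inv_mul_cancel_right₀ hu0]
    have hζe : ζ ^ e = 1 := by
      have h1 : ψ (u ^ e) = u ^ e := hσue
      rw [hζ, mul_pow, ← map_pow, h1, inv_pow, mul_inv_cancel₀ (pow_ne_zero e hu0)]
    have hζ0 : ζ ≠ 0 := fun h ↦ by rw [h, zero_pow he0] at hζe; exact zero_ne_one hζe
    -- the descent datum is the scaling `⟨ζ⁻¹, 0, 0, 0⟩`
    have hCmap : C.map (ψ : L →+* L) = (⟨Units.mk0 ζ hζ0, 0, 0, 0⟩ : VariableChange L) * C := by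
      have h := map_eq_scaling_mul (algebraMap ℚ L) hu0 Cs (ψ : L →+* L) hζ0 hψu
      rw [← hC] at h
      exact h
    have hA : C * (C.map (ψ : L →+* L))⁻¹ = ⟨(Units.mk0 ζ hζ0)⁻¹, 0, 0, 0⟩ :=
      mul_inv_eq_scaling_of_map_eq hCmap
    -- the Serre–Tate reduced automorphism with its lift
    have hσv : ∀ z, specVal v (ψ z) = specVal v z := fun z ↦ spectralValuation_smul (specVal_spec v) σ z
    have hσI' : σ ∈ 𝔐.inertia (absoluteGaloisGroup (v.adicCompletion ℚ)) := by
      rw [inertia_eq_absInertia (specVal_spec v) h𝔐]; exact hσ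
    have hσI : ∀ z, specVal v z ≤ 1 → specVal v (ψ z - z) < 1 :=
      (mem_inertia_iff_spectralValuation (specVal_spec v) h𝔐).1 hσI'
    obtain ⟨A₀, hÃ, hA₀A, hT⟩ := exists_lift_reducedAut_red_map_eq (w := specVal v)
      (W.baseChange (v.adicCompletion ℚ)) C hW₀ hΔ ψ hσv hσI
    -- `Ã = 1`: it fixes the infinitely many reductions of `p`-power torsion points
    let Φ₁ : localPoints W (v.adicCompletion ℚ) ≃+
        ((W.baseChange (v.adicCompletion ℚ)).baseChange L).toAffine.Point :=
      Affine.Point.congrEquiv (baseChange_baseChange_adicCompletion W v).symm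
    have hΦ₁smul : ∀ Q : localPoints W (v.adicCompletion ℚ),
        Φ₁ (σ • Q) = Affine.Point.map (ψ : L →ₐ[v.adicCompletion ℚ] L) (Φ₁ Q) :=
      fun Q ↦ congrEquiv_smul W v σ Q
    have hÃ1 : A₀.map (IsLocalRing.residue (specVal v).integer) = 1 := by
      apply VariableChange.eq_one_of_infinite_fixedPoints hÃ
      refine (infinite_range_red_pointsMap W p hW₀ hΔ red hred hord hpv).mono ?_
      rintro _ ⟨m, rfl⟩
      have h1 := hT (Φ₁ (pointsMap W (v.adicCompletion ℚ) (m : W.geomPoints)))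
      rw [← hΦ₁smul, ← pointsMap_absGaloisRestrict_smul] at h1
      have h2 := hH m
      rw [hLv, AddSubgroupClass.coe_sub, primaryComponent.coe_smul, map_sub, map_sub, sub_eq_zero,
        hred, hred] at h2
      rw [Set.mem_setOf_eq]
      dsimp only
      rw [hred]
      exact (h2 ▸ h1).symm
    -- so the unit `ζ⁻¹` of the descent datum is `≡ 1 (mod 𝔪_w)`
    have hlt := val_coe_u_sub_one_lt_one_of_map_residue_eq_one (L := L) (w := specVal v) hÃ1
    rw [hA₀A, hA] at hlt
    have hcoe : ((((⟨(Units.mk0 ζ hζ0)⁻¹, 0, 0, 0⟩ : VariableChange L)).u : Lˣ) : L) = ζ⁻¹ := by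
      simp
    rw [hcoe] at hlt
    -- an `e`-th root of unity `≡ 1` is `1`
    have hζie : ζ⁻¹ ^ e = 1 := by rw [inv_pow, hζe, inv_one]
    have hζ1 : ζ⁻¹ = 1 := eq_one_of_pow_eq_one_of_specVal_sub_one_lt p hpv he0 hζie hlt hpe
    rw [inv_eq_one] at hζ1
    rw [hψu_def, hψu, hζ1, one_mul]

end Local

end Summit.BirchSwinnertonDyer.Rank1Residual.Additive.GoodModelLine

end
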